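import Literature.MathematicalPhysics.QuantumFieldTheory.Balaban1983to89.B16Ineq197

/-!
# `Balaban1983to89.B16Count196Packing` (v1) — the candidate count behind [Balaban1989LargeFieldII] (1.96), p. 389,
i.e. the LEAF `B16Ineq197.Polymer.Count196` of the cell's typed (1.91) ⇒ (1.97) bookkeeping, DISCHARGED by a kernel
packing lemma from three set-level hypotheses over an abstract M-cube index type

CITATION HEADER (lean-in-tree rule 2026-08-18).  Source under audit (cell paper B16): T. Bałaban, *Large field
renormalization. II. Localization, exponentiation, and bounds for the 𝐑 operation*, Commun. Math. Phys. **122**, 355–392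
(1989), doi:10.1007/bf01238433 [Balaban1989LargeFieldII] (held `paper:balaban1989-cmp122-large-field-ii`; journal page =
PDF page + 354).  Printed, p. 389 [PDF 35], display (1.96), verbatim (render read as an image by the typing unit):
*"Σ_{q≥0} Σ′_{{X_{j_1},…,X_{j_q}}} exp(−q½p₀(g_k)) ≦ Σ_{q≥0} (1/q!) Σ′_{(X_{j_1},…,X_{j_q})} exp(−q½p₀(g_k))
≦ exp(exp(−½p₀(g_k))100^d(MR_k)^{−d}|X′∖∪Y_i|)."*  The second printed inequality USES, without stating it, a bound on
the NUMBER N of class-1 components X_j available inside X′∖⋃Y_i of the form `N ≤ 100^d(MR_k)^{−d}|X′∖∪Y_i|` (then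
Σ′_{(X_{j_1},…,X_{j_q})} e^{−q p/2} ≤ (N e^{−p/2})^q and Σ_q (1/q!)(N e^{−p/2})^q ≤ exp(N e^{−p/2})).  In the cell's typed
bookkeeping `…Balaban1983to89.B16Ineq197` (unit b02, gen 14; v1.1) this count is the quoted LEAF
`Polymer.Count196 : (#cand : ℝ) ≤ ρ · v` with `v = M^{−d}|X′∖⋃Y_i|` and ρ the "candidate density" (print: 100^d R_k^{−d}).
The paper is a manuscript UNDER ADJUDICATION by the audit cell `pub-balaban`: NOTHING printed in it is asserted here.  The
cell's certified READING of why the count holds (SMALLNESS.md row S-B16.13 ⟦v2.24⟧; GAPS.md C-adv7-64, cross-read by reader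
group r2-g19) — *the X_{j_h} are pairwise disjoint, lie in X′∖∪Y_i, and each contains an MR_k-cube, hence ≥ R_k^d M-cubes* —
enters below ONLY as three named HYPOTHESES (`hdisj`, `hsub`, `hbig`) over an abstract finite type of "M-cubes"; the module
proves the elementary packing arithmetic that turns them into `Count196`, with the SHARP density n⁻¹ (= R_k^{−d} when each
component holds n = R_k^d cubes) and records that the printed 100^d R_k^{−d} is slack by the factor 100^d (as S-B16.13 says).
A prior SCRATCH kernel of the same arithmetic exists in the cell (adversarial reader 7, gen 34, `count_le_vol`: real volumes,
Σ vol ≤ V and vol ≥ v ⇒ #s ≤ V/v); it is re-proved here in the finite-set form needed by the leaf, not cited.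

WHAT IS PROVED (no `sorry`, no new axioms; every theorem tagged [folklore] is elementary finite combinatorics / arithmetic):
`card_mul_le_card_of_pairwiseDisjoint` — k pairwise disjoint sub-finsets of U, each of cardinality ≥ n, force k·n ≤ #U;
`card_le_inv_mul_card` — its real form #S ≤ n⁻¹·#U (n ≥ 1); `count196_of_packing` — for a polymer `P` of
`B16Ineq197` and constants `K`: a cube model (U = the M-cubes of X′∖⋃Y_i with #U ≤ P.v, cubes j ⊆ U pairwise disjoint over
j ∈ P.cand with #(cubes j) ≥ n ≥ 1) and n⁻¹ ≤ K.ρ give `P.Count196 K`; `count196_of_packing_pow` — the same with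
n = R^d and the PRINTED density K.ρ = 100^d·(R^d)⁻¹ (R ≥ 1), via `inv_pow_le_printed` ((R^d)⁻¹ ≤ 100^d (R^d)⁻¹);
`toyB_count196_of_packing` — non-vacuity: the branch-B toy polymer of `B16Ineq197` (one candidate, v = 1, ρ = 1) satisfies the
hypotheses with the one-cube model, and the conclusion is its `Count196`.
WHAT IS *NOT* PROVED: that the class-1 components of the actual 𝐑-operation carriers are disjoint unions of MR_k-cubes inside
X′∖⋃Y_i (lattice geometry of pp. 377–385 — not typed in the cell; the three hypotheses stay OPEN leaves at that level), nor
anything about the other leaves of `B16Ineq197` (`Subadd193`, `Vol193`, `XBudget`, `Anch194`: relative tree lengths, owned by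
the joiner lineages b01 ∕ t4 — `…B14RelAnimalBound`, `…B14RelTreeLength`, `…B16SupCountFloor`).  Value: one quoted leaf of
the (1.97) bookkeeping becomes kernel arithmetic over three print-level set facts; NOT summit progress.
Cell records: GAPS.md C-b02g14-8; HOME/HANDOFF.md (b02 lineage, gen 14, lane (c)).  Naming: `B16Ineq197.Consts` ∕
`B16Ineq197.Polymer` are written QUALIFIED (the cell's `…Balaban1983to89.Consts` of the Setup module shadows the short name
inside this namespace; cf. the note in `B16Ineq197`'s header).
-/

namespace Literature.MathematicalPhysics.QuantumFieldTheory.Balaban1983to89.B16Count196Packing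

open Finset
open Literature.MathematicalPhysics.QuantumFieldTheory.Balaban1983to89.B16Ineq197

/-! ## Part A. The packing lemma -/

/-- **Packing.** If the members `X j`, `j ∈ S`, are pairwise disjoint sub-finsets of `U`, each of cardinality at least `n`,
then `#S · n ≤ #U`. [folklore] -/
theorem card_mul_le_card_of_pairwiseDisjoint {ι C : Type*} [DecidableEq C] (S : Finset ι) (X : ι → Finset C)
    (U : Finset C) (n : ℕ) (hdisj : (S : Set ι).PairwiseDisjoint X) (hsub : ∀ j ∈ S, X j ⊆ U)
    (hbig : ∀ j ∈ S, n ≤ (X j).card) : S.card * n ≤ U.card := by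
  calc S.card * n = ∑ j ∈ S, n := by simp
    _ ≤ ∑ j ∈ S, (X j).card := Finset.sum_le_sum hbig
    _ = (S.biUnion X).card := (Finset.card_biUnion hdisj).symm
    _ ≤ U.card := Finset.card_le_card (Finset.biUnion_subset.2 hsub)

/-- **Packing, real form.** Under the same hypotheses with `n ≥ 1`: `#S ≤ n⁻¹ · #U`. [folklore] -/
theorem card_le_inv_mul_card {ι C : Type*} [DecidableEq C] (S : Finset ι) (X : ι → Finset C)
    (U : Finset C) (n : ℕ) (hn : 0 < n) (hdisj : (S : Set ι).PairwiseDisjoint X) (hsub : ∀ j ∈ S, X j ⊆ U)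
    (hbig : ∀ j ∈ S, n ≤ (X j).card) : (S.card : ℝ) ≤ (n : ℝ)⁻¹ * U.card := by
  have h := card_mul_le_card_of_pairwiseDisjoint S X U n hdisj hsub hbig
  have hn' : (0 : ℝ) < n := by exact_mod_cast hn
  rw [← div_eq_inv_mul, le_div_iff₀ hn']
  exact_mod_cast h

/-- The printed density dominates the sharp one: `(R^d)⁻¹ ≤ 100^d · (R^d)⁻¹` (R ≥ 0). [folklore] -/
theorem inv_pow_le_printed (R : ℝ) (hR : 0 ≤ R) (d : ℕ) : (R ^ d)⁻¹ ≤ (100 : ℝ) ^ d * (R ^ d)⁻¹ := by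
  have h1 : (1 : ℝ) ≤ 100 ^ d := one_le_pow₀ (by norm_num)
  have h0 : 0 ≤ (R ^ d)⁻¹ := inv_nonneg.2 (pow_nonneg hR d)
  nlinarith

/-! ## Part B. The leaf `Count196` from a cube model -/

variable {LF DomY : Type*}

/-- **(1.96)'s count from packing.** Cube model of a polymer `P` (print dictionary: `C` = the M-cubes of the scale-k lattice;
`U` = the M-cubes of X′∖⋃Y_i, so `#U = M^{−d}|X′∖⋃Y_i| = P.v` — only `#U ≤ P.v` is used; `cubes j` = the M-cubes of the
class-1 component X_j; `n` = R_k^d, an MR_k-cube being R_k^d M-cubes): if the `cubes j`, `j ∈ P.cand`, are pairwise disjoint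
subsets of `U` each of cardinality ≥ n ≥ 1 (cell reading S-B16.13 ⟦v2.24⟧, HYPOTHESES here) and `n⁻¹ ≤ K.ρ`, then
`P.Count196 K`, i.e. `#cand ≤ ρ · v`. [folklore] -/
theorem count196_of_packing (P : B16Ineq197.Polymer LF DomY) (K : B16Ineq197.Consts) {C : Type*} [DecidableEq C]
    (U : Finset C) (cubes : LF → Finset C) (n : ℕ) (hn : 0 < n) (hdisj : (P.cand : Set LF).PairwiseDisjoint cubes)
    (hsub : ∀ j ∈ P.cand, cubes j ⊆ U) (hbig : ∀ j ∈ P.cand, n ≤ (cubes j).card) (hU : (U.card : ℝ) ≤ P.v)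
    (hρ : (n : ℝ)⁻¹ ≤ K.ρ) : P.Count196 K := by
  have h := card_le_inv_mul_card P.cand cubes U n hn hdisj hsub hbig
  have hn0 : (0 : ℝ) ≤ (n : ℝ)⁻¹ := inv_nonneg.2 (Nat.cast_nonneg n)
  unfold B16Ineq197.Polymer.Count196
  calc (P.cand.card : ℝ) ≤ (n : ℝ)⁻¹ * U.card := h
    _ ≤ (n : ℝ)⁻¹ * P.v := mul_le_mul_of_nonneg_left hU hn0
    _ ≤ K.ρ * P.v := mul_le_mul_of_nonneg_right hρ P.v_nonneg

/-- **The same with the printed constants** `n = R^d`, `ρ = 100^d (R^d)⁻¹` (print: 100^d R_k^{−d}), `R ≥ 1`. [folklore] -/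
theorem count196_of_packing_pow (P : B16Ineq197.Polymer LF DomY) (K : B16Ineq197.Consts) {C : Type*}
    [DecidableEq C] (U : Finset C) (cubes : LF → Finset C) (R d : ℕ) (hR : 0 < R)
    (hdisj : (P.cand : Set LF).PairwiseDisjoint cubes) (hsub : ∀ j ∈ P.cand, cubes j ⊆ U)
    (hbig : ∀ j ∈ P.cand, R ^ d ≤ (cubes j).card) (hU : (U.card : ℝ) ≤ P.v)
    (hρ : K.ρ = (100 : ℝ) ^ d * ((R : ℝ) ^ d)⁻¹) : P.Count196 K := by
  refine count196_of_packing P K U cubes (R ^ d) (pow_pos hR d) hdisj hsub hbig hU ?_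
  rw [hρ, Nat.cast_pow]
  exact inv_pow_le_printed (R : ℝ) (Nat.cast_nonneg R) d

/-! ## Part C. Non-vacuity: the branch-B toy polymer of `B16Ineq197` with the one-cube model -/

/-- The branch-B toy polymer of `B16Ineq197` (one candidate `()`, `v = 1`) with constants `toyConstsB` (`ρ = 1`) satisfies the
hypotheses of `count196_of_packing` for the cube type `Unit`, `U = {()}`, `cubes () = {()}`, `n = 1`; the conclusion is its
leaf `Count196`. [folklore] -/
theorem toyB_count196_of_packing : toyPolymerB.Count196 toyConstsB :=
  count196_of_packing toyPolymerB toyConstsB (C := Unit) {()} (fun _ => {()}) 1 Nat.one_pos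
    (fun a _ b _ hab => absurd (Subsingleton.elim a b) hab) (fun _ _ => subset_rfl)
    (fun _ _ => by simp) (by simp [toyPolymerB]) (by simp [toyConstsB])

/-- The packing lemma is sharp: two disjoint singletons in a two-element set (k·n = 2 = #U). [folklore] -/
example : (({0, 1} : Finset (Fin 2)).card) * 1 ≤ (Finset.univ : Finset (Fin 2)).card :=
  card_mul_le_card_of_pairwiseDisjoint ({0, 1} : Finset (Fin 2)) (fun i => {i}) Finset.univ 1
    (by
      intro a _ b _ hab
      simpa [Function.onFun] using hab)
    (fun _ _ => Finset.subset_univ _) (fun _ _ => by simp)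

end Literature.MathematicalPhysics.QuantumFieldTheory.Balaban1983to89.B16Count196Packing
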